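import Literature.Probability.RandomPlanarGeometry.HexSAWSurfaceFugacity
import Literature.Probability.RandomPlanarGeometry.HexSAWStripIdentity
import HarnessLib

/-!
# The infinite-strip generating functions with a surface fugacity and BBdGDCG's limit identity (Proposition 9)

Topic `Literature/Probability/RandomPlanarGeometry` (continues `HexSAWStripIdentityY.lean` — BBdGDCG 2014 Proposition 4 at `n = 0`,
`HV.strip_identityY`, `HV.betaY`, over the vocabulary `HV.stripGFy` of `HexSAWStripSurfaceArchCut.lean` —, the capstone
`HexSAWSurfaceFugacity.lean` (whose `HV.stripBy_bddAbove_of_lt` = boundedness of `L ↦ B_{T,L}(x_c,y)` below `y*` is REUSED here,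
not restated), `HexSAWStripELimZeroY.lean` (`HV.stripELimZeroY_holds`) and the tree's `HexSAWStripIdentity.lean`: `HV.stripElim_zero`,
i.e. `E_{T,L}(x_c) → 0`).  Source: N. R. Beaton, M. Bousquet-Mélou, J. de Gier,
H. Duminil-Copin, A. J. Guttmann, *The critical fugacity for surface adsorption of self-avoiding walks on the honeycomb lattice is
`1 + √2`*, Comm. Math. Phys. 326 (2014) 727–754, arXiv:1109.0358 — §4.2 in the arXiv v1 (2011) wording "As L increases, the
polynomials A_{T,L}(x_c,y) and B_{T,L}(x_c,y) count more and more walks … If, in addition, y < y*, … the limits lim_L A_{T,L}(x_c,y)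
and lim_L B_{T,L}(x_c,y) exist and are finite. Clearly, these limits are A_T(x_c,y) and B_T(x_c,y)" (this file follows that v1
argument: positivity of α, ε, β(y) below y* + the identity (16) ⇒ bounded monotone limits; the v5 = CMP text, §4.2 p. 14, runs it at
`y = y*` only — "Hence the limit lim_{L→∞} A_{T,L}(x_c; y*) exists and is finite … this means that y* ≤ y_T" — and DEFINES
A_T(x_c; ·), B_T(x_c; ·) as the generating functions of arches and bridges of the T-strip above Corollary 8, p. 12, with radius
y_T), and §4.3 Proposition 9, eq. (18) (arXiv v5 p. 14: "α A_T(x_c,y) + β(y) B_T(x_c,y) = 1", proved by "lim_L E_{T,L}(x_c,y) = 0 …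
Taking the limit of (16)").  Page numbers below are arXiv v5 throughout.

## What is proved (HOME build of a-p2 g7, 2026-08-23; door R96′ «HEX-YC-DCS», §4.2–4.3 layer)

* `stripGFy_alpha_mono_L`, `stripGFy_beta_mono_L` (domain inclusion), `stripGFy_le_one_of_le_one` (`y ≤ 1`), `stripGFy_alpha_le`
  (`A_{T,L}(x_c,y) ≤ 1/cos(3π/8)` for `0 < y < y*`);
* `stripAyLim T y := sup_L A_{T,L}(x_c,y)`, `stripByLim T y := sup_L B_{T,L}(x_c,y)` with `tendsto_stripAy`, `tendsto_stripBy`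
  (the printed limits, `0 < y < y*`), `le_stripByLim`, `stripByLim_le` (`≤ √2 y/(1 + √2 − y)`: **BBdGDCG §4.2, `y* ≤ y_T` (the
  sentence before (17)), as the finiteness of `B_T(x_c, y)` below `y*`**), `stripAyLim_le`, `stripByLim_one` (`= stripBlim T`);
* `tendsto_stripGFy_eps_of_le_one` — `E_{T,L}(x_c,y) → 0` for `0 ≤ y ≤ 1` (from the tree's `stripElim_zero`);
* **`strip_identity_limY`** — BBdGDCG Proposition 9, eq. (18): `cos(3π/8) A_T(x_c,y) + β(y) B_T(x_c,y) = 1` for `0 < y < y*`,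
  GIVEN `E_{T,L}(x_c,y) → 0` (the face Y3′ `StripELimZeroY` of the door supplies it), and **`strip_identity_limY_of_le_one`** —
  the same UNCONDITIONALLY for `0 < y ≤ 1` (tree only);
* **`strip_identity_limY_of_lt_yStar`** — Proposition 9, eq. (18) UNCONDITIONALLY on the whole printed range below `y*`,
  `0 < y < 1 + √2`: the hypothesis `E → 0` is a-p5's `stripELimZeroY_holds` (`HexSAWStripELimZeroY.lean`) fed with the bound (17).
-/

noncomputable section

open Finset Filter Topology Literature.Probability.LatticeModels Literature.Probability.Percolation

namespace Literature.Probability.RandomPlanarGeometry.SAW.HV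

/-! ### Monotonicity in `L` and elementary bounds -/

/-- `A_{T,L}(x_c, y)` increases with `L` (`y ≥ 0`): larger domains carry more arches, same weights.
[cite: BeatonBousquetMelouDeGierDuminilCopinGuttmann2014, §4.2 (arXiv v5 p. 14: "Hence they increase with L"; v1 wording "their values increase with L")] -/
theorem stripGFy_alpha_mono_L {T L L' : ℕ} (h : L ≤ L') {y : ℝ} (hy : 0 ≤ y) :
    stripGFy T L IsAlphaDart y ≤ stripGFy T L' IsAlphaDart y := by
  have hx : 0 < hexCriticalFugacity := hexCriticalFugacity_pos_lt_one.1
  unfold stripGFy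
  exact sum_le_sum_of_subset_of_nonneg (filter_subset_filter _ (midWalks_mono (stripV_mono_L h)))
    fun _ _ _ => by positivity

/-- `B_{T,L}(x_c, y)` increases with `L` (`y ≥ 0`). [cite: BeatonBousquetMelouDeGierDuminilCopinGuttmann2014, §4.2 (arXiv v5 p. 14)] -/
theorem stripGFy_beta_mono_L {T L L' : ℕ} (h : L ≤ L') {y : ℝ} (hy : 0 ≤ y) :
    stripGFy T L (IsBetaDart T) y ≤ stripGFy T L' (IsBetaDart T) y := by
  have hx : 0 < hexCriticalFugacity := hexCriticalFugacity_pos_lt_one.1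
  unfold stripGFy
  exact sum_le_sum_of_subset_of_nonneg (filter_subset_filter _ (midWalks_mono (stripV_mono_L h)))
    fun _ _ _ => by positivity

/-- For `0 ≤ y ≤ 1` the surface weight only decreases the generating functions: `G(y) ≤ G(1)`.
[cite: BeatonBousquetMelouDeGierDuminilCopinGuttmann2014, §2 (weights y^{c(γ)})] -/
theorem stripGFy_le_one_of_le_one (T L : ℕ) (cls : HV × HV → Prop) [DecidablePred cls] {y : ℝ} (hy0 : 0 ≤ y) (hy1 : y ≤ 1) :
    stripGFy T L cls y ≤ stripGFy T L cls 1 := by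
  have hx : 0 < hexCriticalFugacity := hexCriticalFugacity_pos_lt_one.1
  unfold stripGFy
  exact sum_le_sum fun P _ => mul_le_mul_of_nonneg_left (pow_le_pow_left₀ hy0 hy1 _) (by positivity)

/-- The class generating functions are nonnegative (`y ≥ 0`). [cite: BeatonBousquetMelouDeGierDuminilCopinGuttmann2014, §2] -/
theorem stripGFy_nonneg' (T L : ℕ) (cls : HV × HV → Prop) [DecidablePred cls] {y : ℝ} (hy : 0 ≤ y) : 0 ≤ stripGFy T L cls y :=
  sum_nonneg fun _ _ => mul_nonneg (pow_nonneg hexCriticalFugacity_pos_lt_one.1.le _) (pow_nonneg hy _)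

/-- `A_{T,L}(x_c, y) ≤ 1/cos(3π/8)` for `0 < y < y*` (the other terms of (16) are nonnegative).
[cite: BeatonBousquetMelouDeGierDuminilCopinGuttmann2014, §4.2 (arXiv v5 p. 14)] -/
theorem stripGFy_alpha_le {T L : ℕ} (hT : 1 ≤ T) {y : ℝ} (hy : 0 < y) (hlt : y < 1 + Real.sqrt 2) :
    stripGFy T L IsAlphaDart y ≤ 1 / Real.cos (3 * Real.pi / 8) := by
  have hid := strip_identityY (L := L) hT hy
  have hc : 0 < Real.cos (3 * Real.pi / 8) := cos_three_pi_div_eight_pos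
  have cε : 0 ≤ Real.cos (Real.pi / 4) := (cos_pi_div_four_pos').le
  have hβ : 0 ≤ (1 + Real.sqrt 2 - y) / (Real.sqrt 2 * y) := div_nonneg (by linarith) (by positivity)
  have hB := stripGFy_nonneg' T L (IsBetaDart T) hy.le
  have hE := stripGFy_nonneg' T L (IsEpsDart L) hy.le
  rw [le_div_iff₀ hc]
  nlinarith [mul_nonneg hβ hB, mul_nonneg cε hE]

/-! ### The limits `A_T(x_c, y)`, `B_T(x_c, y)` -/

/-- `A_T(x_c, y) := sup_L A_{T,L}(x_c, y)` (`= lim_L` below `y*`). [cite: BeatonBousquetMelouDeGierDuminilCopinGuttmann2014, §4.2 (arXiv v5 p. 14)] -/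
def stripAyLim (T : ℕ) (y : ℝ) : ℝ := ⨆ L : ℕ, stripGFy T L IsAlphaDart y

/-- `B_T(x_c, y) := sup_L B_{T,L}(x_c, y)` (`= lim_L` below `y*`). [cite: BeatonBousquetMelouDeGierDuminilCopinGuttmann2014, §4.2 (arXiv v5 p. 14)] -/
def stripByLim (T : ℕ) (y : ℝ) : ℝ := ⨆ L : ℕ, stripGFy T L (IsBetaDart T) y

/-- Below `y*` the arches are bounded in `L`. [cite: BeatonBousquetMelouDeGierDuminilCopinGuttmann2014, §4.2 (arXiv v5 p. 14)] -/
theorem bddAbove_stripGFy_alpha {T : ℕ} (hT : 1 ≤ T) {y : ℝ} (hy : 0 < y) (hlt : y < 1 + Real.sqrt 2) :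
    BddAbove (Set.range fun L : ℕ => stripGFy T L IsAlphaDart y) :=
  ⟨_, by rintro _ ⟨L, rfl⟩; exact stripGFy_alpha_le hT hy hlt⟩

/-- `A_{T,L}(x_c,y) → A_T(x_c,y)` as `L → ∞` (`0 < y < y*`). [cite: BeatonBousquetMelouDeGierDuminilCopinGuttmann2014, §4.2 (arXiv v5 p. 14: "Hence the limit lim_{L→∞} A_{T,L}(x_c; y*) exists and is finite"; v1 wording "the limits … exist and are finite")] -/
theorem tendsto_stripAy {T : ℕ} (hT : 1 ≤ T) {y : ℝ} (hy : 0 < y) (hlt : y < 1 + Real.sqrt 2) :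
    Tendsto (fun L : ℕ => stripGFy T L IsAlphaDart y) atTop (𝓝 (stripAyLim T y)) :=
  tendsto_atTop_ciSup (fun _ _ h => stripGFy_alpha_mono_L h hy.le) (bddAbove_stripGFy_alpha hT hy hlt)

/-- `B_{T,L}(x_c,y) → B_T(x_c,y)` as `L → ∞` (`0 < y < y*`). [cite: BeatonBousquetMelouDeGierDuminilCopinGuttmann2014, §4.2 (arXiv v5 p. 14)] -/
theorem tendsto_stripBy {T : ℕ} (hT : 1 ≤ T) {y : ℝ} (hy : 0 < y) (hlt : y < 1 + Real.sqrt 2) :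
    Tendsto (fun L : ℕ => stripGFy T L (IsBetaDart T) y) atTop (𝓝 (stripByLim T y)) :=
  tendsto_atTop_ciSup (fun _ _ h => stripGFy_beta_mono_L h hy.le) (stripBy_bddAbove_of_lt hT hy hlt)

/-- `B_{T,L}(x_c,y) ≤ B_T(x_c,y)` (`0 < y < y*`). [cite: BeatonBousquetMelouDeGierDuminilCopinGuttmann2014, §4.2] -/
theorem le_stripByLim {T : ℕ} (hT : 1 ≤ T) {y : ℝ} (hy : 0 < y) (hlt : y < 1 + Real.sqrt 2) (L : ℕ) :
    stripGFy T L (IsBetaDart T) y ≤ stripByLim T y :=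
  le_ciSup (stripBy_bddAbove_of_lt hT hy hlt) L

/-- **BBdGDCG §4.2: `B_T(x_c, y) < ∞` for `y < y*`** (the `y* ≤ y_T` half), quantitatively `B_T(x_c,y) ≤ √2 y/(1 + √2 − y)`
("this means that y* ≤ y_T"; (17) itself is the consequence `y* ≤ y_c`). [cite: BeatonBousquetMelouDeGierDuminilCopinGuttmann2014, §4.2 (arXiv v5 p. 14, the sentence before eq. (17))] -/
theorem stripByLim_le {T : ℕ} (hT : 1 ≤ T) {y : ℝ} (hy : 0 < y) (hlt : y < 1 + Real.sqrt 2) :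
    stripByLim T y ≤ Real.sqrt 2 * y / (1 + Real.sqrt 2 - y) :=
  ciSup_le fun _ => stripGFy_beta_le hT hy hlt

/-- `A_T(x_c, y) ≤ 1/cos(3π/8)` for `0 < y < y*`. [cite: BeatonBousquetMelouDeGierDuminilCopinGuttmann2014, §4.2 (arXiv v5 p. 14)] -/
theorem stripAyLim_le {T : ℕ} (hT : 1 ≤ T) {y : ℝ} (hy : 0 < y) (hlt : y < 1 + Real.sqrt 2) :
    stripAyLim T y ≤ 1 / Real.cos (3 * Real.pi / 8) :=
  ciSup_le fun _ => stripGFy_alpha_le hT hy hlt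

/-- At `y = 1`, `B_T(x_c, 1)` is the tree's `B_T(x_c)` (`HV.stripBlim`). [cite: DuminilCopinSmirnov2012, §3 (B_T)] -/
theorem stripByLim_one (T : ℕ) : stripByLim T 1 = stripBlim T := by
  simp only [stripByLim, stripBlim, stripGFy_beta_one]

/-! ### `E_{T,L}(x_c, y) → 0` for `y ≤ 1` and the limit identity -/

/-- For `0 ≤ y ≤ 1`: `E_{T,L}(x_c, y) ≤ E_{T,L}(x_c) → 0` (the tree's `stripElim_zero`).
[cite: BeatonBousquetMelouDeGierDuminilCopinGuttmann2014, §4.3 (proof of Proposition 9: lim_L E_{T,L}(x_c,y) = 0)] -/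
theorem tendsto_stripGFy_eps_of_le_one {T : ℕ} (hT : 1 ≤ T) {y : ℝ} (hy0 : 0 ≤ y) (hy1 : y ≤ 1) :
    Tendsto (fun L : ℕ => stripGFy T L (IsEpsDart L) y) atTop (𝓝 0) := by
  have hE : Tendsto (fun L : ℕ => stripE T L hexCriticalFugacity) atTop (𝓝 0) := by
    have h := tendsto_stripE DuminilCopinSmirnov2012_lemma2_holds hT
    rwa [stripElim_zero hT] at h
  refine tendsto_of_tendsto_of_tendsto_of_le_of_le tendsto_const_nhds hE
    (fun L => stripGFy_nonneg' T L (IsEpsDart L) hy0) fun L => ?_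
  rw [← stripGFy_eps_one]
  exact stripGFy_le_one_of_le_one T L (IsEpsDart L) hy0 hy1

/-- **BBdGDCG Proposition 9, eq. (18)** for `0 < y < y*`, given `lim_L E_{T,L}(x_c, y) = 0` (face Y3′ of the door; unconditional
for `y ≤ 1` below): `cos(3π/8) A_T(x_c,y) + β(y) B_T(x_c,y) = 1` ("Taking the limit of (16) as L → ∞ gives the proposition").
[cite: BeatonBousquetMelouDeGierDuminilCopinGuttmann2014, Proposition 9, eq. (18) (arXiv v5 p. 14)] -/
theorem strip_identity_limY {T : ℕ} (hT : 1 ≤ T) {y : ℝ} (hy : 0 < y) (hlt : y < 1 + Real.sqrt 2)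
    (hE : Tendsto (fun L : ℕ => stripGFy T L (IsEpsDart L) y) atTop (𝓝 0)) :
    Real.cos (3 * Real.pi / 8) * stripAyLim T y + betaY y * stripByLim T y = 1 := by
  have hlim : Tendsto (fun L : ℕ => Real.cos (3 * Real.pi / 8) * stripGFy T L IsAlphaDart y +
      Real.cos (Real.pi / 4) * stripGFy T L (IsEpsDart L) y + betaY y * stripGFy T L (IsBetaDart T) y) atTop
      (𝓝 (Real.cos (3 * Real.pi / 8) * stripAyLim T y + Real.cos (Real.pi / 4) * 0 + betaY y * stripByLim T y)) :=
    (((tendsto_stripAy hT hy hlt).const_mul _).add (hE.const_mul _)).add ((tendsto_stripBy hT hy hlt).const_mul _)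
  have hconst : (fun L : ℕ => Real.cos (3 * Real.pi / 8) * stripGFy T L IsAlphaDart y +
      Real.cos (Real.pi / 4) * stripGFy T L (IsEpsDart L) y + betaY y * stripGFy T L (IsBetaDart T) y) = fun _ => 1 :=
    funext fun L => stripIdentityY_holds T L y hT hy
  rw [hconst] at hlim
  have h := tendsto_nhds_unique tendsto_const_nhds hlim
  linarith

/-- **BBdGDCG Proposition 9, eq. (18), unconditionally for `0 < y ≤ 1`**: `cos(3π/8) A_T(x_c,y) + β(y) B_T(x_c,y) = 1`
(at `y = 1`: the tree's `strip_identity_lim`, DCS eq. (5)). [cite: BeatonBousquetMelouDeGierDuminilCopinGuttmann2014, Proposition 9, eq. (18) (arXiv v5 p. 14)] -/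
theorem strip_identity_limY_of_le_one {T : ℕ} (hT : 1 ≤ T) {y : ℝ} (hy : 0 < y) (hy1 : y ≤ 1) :
    Real.cos (3 * Real.pi / 8) * stripAyLim T y + betaY y * stripByLim T y = 1 :=
  strip_identity_limY hT hy (by have : (1 : ℝ) < Real.sqrt 2 := Real.one_lt_sqrt_two; linarith)
    (tendsto_stripGFy_eps_of_le_one hT hy.le hy1)

/-- **BBdGDCG Proposition 9, eq. (18), UNCONDITIONALLY for `0 < y < y* = 1 + √2`**: `cos(3π/8) A_T(x_c,y) + β(y) B_T(x_c,y) = 1`.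
The printed range is `0 ≤ y < y_T` with `y* ≤ y_T` ((17)); here the sub-range `y < y*`, on which the lane's `E_{T,L}(x_c,y) → 0`
(`stripELimZeroY_holds`, from the boundedness (17) of the bridges) needs no radius-of-convergence input.
[cite: BeatonBousquetMelouDeGierDuminilCopinGuttmann2014, Proposition 9, eq. (18) (arXiv v5 p. 14)] -/
theorem strip_identity_limY_of_lt_yStar {T : ℕ} (hT : 1 ≤ T) {y : ℝ} (hy : 0 < y) (hlt : y < 1 + Real.sqrt 2) :
    Real.cos (3 * Real.pi / 8) * stripAyLim T y + betaY y * stripByLim T y = 1 :=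
  strip_identity_limY hT hy hlt
    (stripELimZeroY_holds T y _ hT hy fun _ => stripGFy_beta_le hT hy hlt)

end Literature.Probability.RandomPlanarGeometry.SAW.HV
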